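import Literature.MathematicalPhysics.QuantumFieldTheory.Balaban1983to89.B6SectA

/-!
# `Balaban1983to89.B6Eq218Lagrangian` — T. Bałaban, *Propagators and renormalization transformations for lattice gauge
# theories. II*, Commun. Math. Phys. **96** (1984) 223–250 [Balaban1984PropagatorsII], Sect. A: the variational problem
# (2.5)–(2.6) with the gauge condition (2.12), its Lagrange functional (2.18), and the critical-point equations (2.21)
# DERIVED (the three variations of (2.18) ARE the three members of (2.21)) — with the Lagrange principle linking (2.21)
# to the critical configurations of (2.5), so that the sentence *"exactly one critical configuration of (2.5) satisfying
# (2.6), (2.12), and given by (2.35)"* is a theorem about (2.5) itself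

statement-level skeleton of published theorems with citation tags; proofs where landed; nothing here is a claim about the Yang–Mills mass gap

PDF held: `paper:balaban1984-cmp96-propagators-rt-ii` (journal page = PDF page + 222); read AS IMAGES on the ×2 renders
`run/shared/lean/pub/pub-balaban/b2b-balaban-ref1/pages/1984-cmp96-propagators-rt-II/…-p002…-p006-x2.png` (pp. 224–228).

CITATION HEADER (lean-in-tree rule).  WHAT IS REPRODUCED: lit-balaban SKELETON rows **B6.Eq2.5** ((2.5)–(2.6): until now
`typed` only as *"the constraint + critical-point system"*), **B6.Eq2.18** ((2.18): until now `typed` only *"as (2.21)"*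
— the Lagrange functional had no Lean body) and the derivation half of **B6.Eq2.21** (the displays `δh/δA = …`,
`δh/δλ = …`, `δh/δω = …` themselves; the consequence (2.21) ⇒ (2.35) is `…B6SectA.critical221_unique`, p238845).
Unit `lit-balaban-r03` (B6 reader/typer and fold owner, gen 3), PHASE 2 (G.1/G.2(b): typed-not-proved rows of the
seat's own block), HOME `run/shared/lean/pub/lit-balaban/`, 2026-08-21.  IMPORTS `…B6SectA` (this unit, p238845)
for `hOp` (2.35), `critical221_unique`, `critical221_exists` — consumed BY NAME, nothing restated; the analogous
treatment of paper I's Lagrange function (1.48)/(1.49) on the concrete double torus is `…B5Lagrange149Torus` (another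
seat; not imported — the present file is the ABSTRACT real-inner-product-space version for paper II's multi-scale
system, whose extra data are the projection `R` in `Δ_a` and the term `−½a⟨B,B⟩`).

PRINT (pp. 224–228, verbatim).  *"We consider the functional A → Σ_p η^d|(∂A)(p)|² (2.5) for A fixed outside Ω₁ and
with fixed averages inside Ω₁, more exactly A = B₀ on Λ₀, Q_jA = B_j on Λ_j, j = 1, …, k. (2.6)"*; p. 225: *"This
minimum satisfies the equation R∂*A^{λ₀} = 0, or R∂*A = 0 if we take A^{λ₀} as A. (2.12)"*; p. 226: *"Now let us
consider the variational problem (2.5), (2.6) with the additional condition (2.12). We will solve it using Lagrange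
multipliers also, so let us introduce the Lagrange function
h(A, λ, ω) = ½⟨A, Δ_aA⟩ − ½a⟨B, B⟩ − ⟨λ, R∂*A⟩ − ⟨ω, QA − B⟩, Rλ = λ, (2.18) where
Δ_a = ∂*∂ + ∂R∂* + Q*aQ = Δ − ∂P∂* + Q*aQ, (2.19) and the operator Q is given by (QA)(b) = (Q_jA)(b) for b ∈ Λ_j,
(Q₀A)(b) = A(b). (2.20) The scalar products above are suitably weighted … We will seek a critical point of the function
h. It is unique if it exists and it gives a solution of the above variational problem. We have the equations for it:
δh/δA = Δ_aA − ∂Rλ − Q*ω = 0, δh/δλ = −R∂*A = 0, δh/δω = −(QA − B) = 0. (2.21)"*; p. 228: *"Thus we have proved that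
there exists exactly one solution of the equations (2.21), hence exactly one critical configuration of (2.5) satisfying
(2.6), (2.12), and given by (2.35)."*

WHAT IS TYPED / PROVED (0 sorry, 0 new named facts; every hypothesis is a displayed binder).
§1 `energy` = (2.5) `‖∂A‖²` (`∂` = `dc : A → P`, vector fields → plaquette fields); `Admissible` = (2.6) ∧ (2.12)
   (`QA = B`, `R∂*A = 0`); `tangent` = the directions preserving them (`Qv = 0`, `R∂*v = 0`); `IsCritical` = admissible
   and the first variation of (2.5) vanishes along `tangent` — justified by the exact expansion `energy_add`
   (`‖∂(A+v)‖² = ‖∂A‖² + 2⟨∂A,∂v⟩ + ‖∂v‖²`); minimisers are critical (`isCritical_of_isMinOn`).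
§2 `lagrangeH` = (2.18) with a body (`a` an operator on the `B`-space; print's scalar `a` is `a·1`,
   `½a⟨B,B⟩ = ½⟨B,aB⟩`).
§3 (2.21) DERIVED: the exact expansions of `h` in each variable (`lagrangeH_add_A/_add_lam/_add_omega`: linear parts
   `⟨A′, Δ_aA − ∂Rλ − Q*ω⟩`, `−⟨λ′, R∂*A⟩`, `−⟨ω′, QA − B⟩`), and the three GRADIENTS in Mathlib's sense
   (`hasGradientAt_A : ∇_A h = Δ_aA − ∂Rλ − Q*ω` on a finite-dimensional `A`, where `Δ_a` is continuous;
   `hasGradientAt_lam : ∇_λ h = −R∂*A`; `hasGradientAt_omega : ∇_ω h = −(QA − B)`; signs AS PRINTED); `EL221` = the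
   system (2.21); `el221_iff_gradient_eq_zero` — (2.21) ⟺ the three gradients vanish.
§4 the design of (2.18): on the admissible set `h(A, λ, ω) = ½·(2.5)` (`lagrangeH_eq_half_energy`, from the form of
   (2.19) `⟨A′, Δ_aA″⟩ = ⟨∂A′,∂A″⟩ + ⟨∂*A′,R∂*A″⟩ + ⟨QA′,aQA″⟩`, `inner_deltaA`).
§5 THE LAGRANGE PRINCIPLE for (2.5)/(2.6)/(2.12): a solution of (2.21) is a critical configuration
   (`isCritical_of_el221`) and a GLOBAL MINIMISER of (2.5) on the admissible set (`energy_le_of_isCritical`, convexity);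
   conversely (finite dimension, `R` an orthogonal projection) every critical configuration carries multipliers solving
   (2.21) (`exists_el221_of_isCritical`: `∂*∂A ⊥ ker Q ∩ ker R∂*` ⇒ `∂*∂A ∈ ran Q* + ran ∂R`, by
   `Submodule.inf_orthogonal` + `Submodule.orthogonal_orthogonal`; private helpers `eq_zero_of_quadratic_nonneg`, `hasGradientAt_of_expansion`, `ker_eq_orthogonal_range` are folklore plumbing).
§6 *"exactly one critical configuration of (2.5) satisfying (2.6), (2.12), and given by (2.35)"*: with the inputs the
   text names (invertibility of `Δ_a` and of `QGQ*`, the Faddeev–Popov identities (2.31), (2.34) — theorems of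
   `…B6Eq231` under its structural hypotheses) every critical configuration equals `HB = GQ*(QGQ*)⁻¹B`
   (`isCritical_unique`, via `…B6SectA.critical221_unique`), `HB` is one (`isCritical_hOp`, via `critical221_exists`),
   hence `∃!` (`existsUnique_isCritical`).
READINGS (none is an objection to print).  (a) Abstract real inner-product spaces `P, A, V, W` for plaquette fields,
vector fields, scalar functions, multi-scale averages; *"the scalar products above are suitably weighted"* = whatever
inner products the carriers carry; adjoints are hypotheses `⟨Q*w, A⟩ = ⟨w, QA⟩` etc.  (b) (2.19) enters §4–§6 as the
operator identity `Δ_a = ∂*∂ + ∂R∂* + Q*aQ` (`hΔa`; this is `B6SectA.deltaA` by `B6SectA.deltaA_eq_of_hodge`).  (c) The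
boundary datum `A = B₀ on Λ₀` of (2.6) is the `j = 0` component of `QA = B` by (2.20) `(Q₀A)(b) = A(b)` — one
constraint map `Q`, as in print.  (d) `R` *"an orthogonal projection … onto ΔN(Q′)"* (p. 225): symmetric (`hR`) and
idempotent (`hRR`) where used; `Rλ = λ` is carried as in print.
-/

noncomputable section

open scoped InnerProductSpace Gradient
open InnerProductSpace

namespace Literature.MathematicalPhysics.QuantumFieldTheory.Balaban1983to89.B6Eq218Lagrangian

variable {P A V W : Type*}
  [NormedAddCommGroup P] [InnerProductSpace ℝ P]
  [NormedAddCommGroup A] [InnerProductSpace ℝ A]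
  [NormedAddCommGroup V] [InnerProductSpace ℝ V]
  [NormedAddCommGroup W] [InnerProductSpace ℝ W]

/-! ## §1 (2.5)–(2.6), (2.12): the variational problem and its critical configurations -/

/-- (2.5) p. 224: the functional `A → Σ_p η^d|(∂A)(p)|² = ‖∂A‖²` (`dc` = `∂` from vector fields to plaquette fields,
the norm that of the plaquette-field space). [cite: Balaban1984PropagatorsII, (2.5) p.224] -/
def energy (dc : A →ₗ[ℝ] P) (x : A) : ℝ := ‖dc x‖ ^ 2

/-- (2.6) with (2.12) pp. 224–225: the admissible configurations `QA = B` (all scales at once, (2.20): `A = B₀ on Λ₀`,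
`Q_jA = B_j on Λ_j`) and `R∂*A = 0`. [cite: Balaban1984PropagatorsII, (2.6) p.224 + (2.12) p.225] -/
def Admissible (Q : A →ₗ[ℝ] W) (dstar : A →ₗ[ℝ] V) (Rp : V →ₗ[ℝ] V) (B : W) (x : A) : Prop :=
  Q x = B ∧ Rp (dstar x) = 0

/-- The directions preserving (2.6) and (2.12): `Qv = 0`, `R∂*v = 0` (the tangent space of the admissible affine set).
[cite: Balaban1984PropagatorsII, (2.6) p.224 + (2.12) p.225] -/
def tangent (Q : A →ₗ[ℝ] W) (dstar : A →ₗ[ℝ] V) (Rp : V →ₗ[ℝ] V) : Submodule ℝ A :=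
  LinearMap.ker Q ⊓ LinearMap.ker (Rp ∘ₗ dstar)

/-- Membership in `tangent`, unfolded. [cite: Balaban1984PropagatorsII, (2.6) p.224 + (2.12) p.225] -/
theorem mem_tangent_iff (Q : A →ₗ[ℝ] W) (dstar : A →ₗ[ℝ] V) (Rp : V →ₗ[ℝ] V) (v : A) :
    v ∈ tangent Q dstar Rp ↔ Q v = 0 ∧ Rp (dstar v) = 0 := by
  simp [tangent, Submodule.mem_inf, LinearMap.mem_ker]

/-- *"a critical configuration of (2.5) satisfying (2.6), (2.12)"* (p. 228): admissible, and the first variation of (2.5)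
along every admissible direction vanishes (`energy_add`: that variation is `2⟨∂A, ∂v⟩`). [cite: Balaban1984PropagatorsII, (2.5)–(2.6) p.224 + p.228 after (2.35)] -/
def IsCritical (dc : A →ₗ[ℝ] P) (Q : A →ₗ[ℝ] W) (dstar : A →ₗ[ℝ] V) (Rp : V →ₗ[ℝ] V) (B : W) (x : A) :
    Prop :=
  Admissible Q dstar Rp B x ∧ ∀ v ∈ tangent Q dstar Rp, ⟪dc x, dc v⟫_ℝ = 0

/-- The functional (2.5) is a quadratic form: `‖∂(A + v)‖² = ‖∂A‖² + 2⟨∂A, ∂v⟩ + ‖∂v‖²` (exact; its linear part in `v`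
is the first variation used in `IsCritical`). [cite: Balaban1984PropagatorsII, (2.5) p.224] -/
theorem energy_add (dc : A →ₗ[ℝ] P) (x v : A) :
    energy dc (x + v) = energy dc x + 2 * ⟪dc x, dc v⟫_ℝ + energy dc v := by
  simp only [energy, map_add]
  exact norm_add_sq_real (dc x) (dc v)

/-- (2.5) is non-negative. [cite: Balaban1984PropagatorsII, (2.5) p.224] -/
theorem energy_nonneg (dc : A →ₗ[ℝ] P) (x : A) : 0 ≤ energy dc x := by
  unfold energy; positivity

/-- (2.5) scales quadratically. [cite: Balaban1984PropagatorsII, (2.5) p.224] -/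
theorem energy_smul (dc : A →ₗ[ℝ] P) (t : ℝ) (v : A) : energy dc (t • v) = t ^ 2 * energy dc v := by
  simp only [energy, map_smul, norm_smul, Real.norm_eq_abs, mul_pow, sq_abs]

/-- Admissible points differ by tangent directions. [cite: Balaban1984PropagatorsII, (2.6) p.224 + (2.12) p.225] -/
theorem sub_mem_tangent {Q : A →ₗ[ℝ] W} {dstar : A →ₗ[ℝ] V} {Rp : V →ₗ[ℝ] V} {B : W} {x y : A}
    (hx : Admissible Q dstar Rp B x) (hy : Admissible Q dstar Rp B y) : y - x ∈ tangent Q dstar Rp := by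
  rw [mem_tangent_iff]
  refine ⟨?_, ?_⟩
  · rw [map_sub, hx.1, hy.1, sub_self]
  · rw [map_sub, map_sub, hx.2, hy.2, sub_self]

/-- Moving from an admissible point along a tangent direction stays admissible. [cite: Balaban1984PropagatorsII, (2.6) p.224 + (2.12) p.225] -/
theorem admissible_add_smul {Q : A →ₗ[ℝ] W} {dstar : A →ₗ[ℝ] V} {Rp : V →ₗ[ℝ] V} {B : W} {x v : A}
    (hx : Admissible Q dstar Rp B x) (hv : v ∈ tangent Q dstar Rp) (t : ℝ) :
    Admissible Q dstar Rp B (x + t • v) := by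
  rw [mem_tangent_iff] at hv
  refine ⟨?_, ?_⟩
  · rw [map_add, map_smul, hv.1, smul_zero, add_zero, hx.1]
  · rw [map_add, map_smul, map_add, map_smul, hv.2, smul_zero, add_zero, hx.2]

/-- An elementary fact about real quadratics: `0 ≤ 2tc + t²e` for all `t` (with `e ≥ 0`) forces `c = 0`. [folklore] -/
private theorem eq_zero_of_quadratic_nonneg {c e : ℝ} (he : 0 ≤ e) (h : ∀ t : ℝ, 0 ≤ 2 * t * c + t ^ 2 * e) : c = 0 := by
  by_contra hc
  have hc2 : 0 < c ^ 2 := by positivity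
  have he1 : (0 : ℝ) < e + 1 := by linarith
  have ht := h (-c / (e + 1))
  have hcalc : 2 * (-c / (e + 1)) * c + (-c / (e + 1)) ^ 2 * e = -(c ^ 2 * (e + 2)) / (e + 1) ^ 2 := by
    field_simp
    ring
  rw [hcalc] at ht
  have hneg : -(c ^ 2 * (e + 2)) / (e + 1) ^ 2 < 0 :=
    div_neg_of_neg_of_pos (by nlinarith) (by positivity)
  linarith

/-- A MINIMISER of (2.5) on the admissible set (2.6), (2.12) is a critical configuration (the variational problem of
p. 226, *"We will seek a critical point"*). [cite: Balaban1984PropagatorsII, (2.5)–(2.6) p.224 + p.226 before (2.18)] -/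
theorem isCritical_of_isMinOn {dc : A →ₗ[ℝ] P} {Q : A →ₗ[ℝ] W} {dstar : A →ₗ[ℝ] V} {Rp : V →ₗ[ℝ] V} {B : W}
    {x : A} (hx : Admissible Q dstar Rp B x)
    (hmin : ∀ y, Admissible Q dstar Rp B y → energy dc x ≤ energy dc y) :
    IsCritical dc Q dstar Rp B x := by
  refine ⟨hx, fun v hv => ?_⟩
  apply eq_zero_of_quadratic_nonneg (energy_nonneg dc v)
  intro t
  have h1 := hmin (x + t • v) (admissible_add_smul hx hv t)
  rw [energy_add, energy_smul, map_smul, real_inner_smul_right] at h1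
  linarith

/-! ## §2 (2.18): the Lagrange functional -/

/-- **(2.18) p. 226**: `h(A, λ, ω) = ½⟨A, Δ_aA⟩ − ½a⟨B, B⟩ − ⟨λ, R∂*A⟩ − ⟨ω, QA − B⟩` (side condition `Rλ = λ` carried
by the users), with `Δ_a` of (2.19) (`B6SectA.deltaA`), `Q` of (2.20); `a` an operator on the `B`-space (print: the
number `a`, i.e. `a·1`, so that `½a⟨B,B⟩ = ½⟨B, aB⟩`). [cite: Balaban1984PropagatorsII, (2.18) p.226] -/
def lagrangeH (ΔA : A →ₗ[ℝ] A) (a : W →ₗ[ℝ] W) (dstar : A →ₗ[ℝ] V) (Rp : V →ₗ[ℝ] V)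
    (Q : A →ₗ[ℝ] W) (B : W) (x : A) (lam : V) (ω : W) : ℝ :=
  (1 / 2) * ⟪x, ΔA x⟫_ℝ - (1 / 2) * ⟪B, a B⟫_ℝ - ⟪lam, Rp (dstar x)⟫_ℝ - ⟪ω, Q x - B⟫_ℝ

/-! ## §3 (2.21): the variations of `h` — exact expansions, gradients, and the critical-point system -/

section Variations

variable (ΔA : A →ₗ[ℝ] A) (a : W →ₗ[ℝ] W) (d : V →ₗ[ℝ] A) (dstar : A →ₗ[ℝ] V) (Rp : V →ₗ[ℝ] V)
  (Q : A →ₗ[ℝ] W) (Qs : W →ₗ[ℝ] A) (B : W)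

/-- **δh/δA (2.21)**: the exact expansion of (2.18) in `A` — linear part `⟨A′, Δ_aA − ∂Rλ − Q*ω⟩` (so
*"δh/δA = Δ_aA − ∂Rλ − Q*ω"*), quadratic part `½⟨A′, Δ_aA′⟩`.  Hypotheses: `Δ_a` symmetric, `∂` the adjoint of `∂*`,
`R` symmetric, `Q*` the adjoint of `Q`. [cite: Balaban1984PropagatorsII, (2.21) p.226] -/
theorem lagrangeH_add_A (hΔ : ∀ x y : A, ⟪ΔA x, y⟫_ℝ = ⟪x, ΔA y⟫_ℝ)
    (hd : ∀ (v : V) (x : A), ⟪d v, x⟫_ℝ = ⟪v, dstar x⟫_ℝ) (hR : ∀ u v : V, ⟪Rp u, v⟫_ℝ = ⟪u, Rp v⟫_ℝ)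
    (hQ : ∀ (w : W) (x : A), ⟪Qs w, x⟫_ℝ = ⟪w, Q x⟫_ℝ) (x x' : A) (lam : V) (ω : W) :
    lagrangeH ΔA a dstar Rp Q B (x + x') lam ω =
      lagrangeH ΔA a dstar Rp Q B x lam ω + ⟪x', ΔA x - d (Rp lam) - Qs ω⟫_ℝ + (1 / 2) * ⟪x', ΔA x'⟫_ℝ := by
  have h1 : ⟪x, ΔA x'⟫_ℝ = ⟪x', ΔA x⟫_ℝ := by rw [← hΔ, real_inner_comm]
  have h2 : ⟪lam, Rp (dstar x')⟫_ℝ = ⟪x', d (Rp lam)⟫_ℝ := by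
    rw [← hR, ← hd, real_inner_comm]
  have h3 : ⟪ω, Q x'⟫_ℝ = ⟪x', Qs ω⟫_ℝ := by rw [← hQ, real_inner_comm]
  simp only [lagrangeH, map_add, inner_add_left, inner_add_right, inner_sub_right, add_sub_assoc]
  rw [h1, h2, h3]
  ring

/-- **δh/δλ (2.21)**: `h(A, λ + λ′, ω) = h(A, λ, ω) − ⟨λ′, R∂*A⟩` (so *"δh/δλ = −R∂*A"*). [cite: Balaban1984PropagatorsII, (2.21) p.226] -/
theorem lagrangeH_add_lam (x : A) (lam lam' : V) (ω : W) :
    lagrangeH ΔA a dstar Rp Q B x (lam + lam') ω =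
      lagrangeH ΔA a dstar Rp Q B x lam ω - ⟪lam', Rp (dstar x)⟫_ℝ := by
  simp only [lagrangeH, inner_add_left]
  ring

/-- **δh/δω (2.21)**: `h(A, λ, ω + ω′) = h(A, λ, ω) − ⟨ω′, QA − B⟩` (so *"δh/δω = −(QA − B)"*). [cite: Balaban1984PropagatorsII, (2.21) p.226] -/
theorem lagrangeH_add_omega (x : A) (lam : V) (ω ω' : W) :
    lagrangeH ΔA a dstar Rp Q B x lam (ω + ω') =
      lagrangeH ΔA a dstar Rp Q B x lam ω - ⟪ω', Q x - B⟫_ℝ := by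
  simp only [lagrangeH, inner_add_left]
  ring

/-- **THE CRITICAL-POINT SYSTEM (2.21)** *"δh/δA = Δ_aA − ∂Rλ − Q*ω = 0, δh/δλ = −R∂*A = 0, δh/δω = −(QA − B) = 0"*
as a proposition about `(A, λ, ω)` for the datum `B` (the last two members in the equivalent forms `R∂*A = 0`,
`QA = B`, which are the hypotheses `h2`, `h3` of `B6SectA.critical221_unique`; `el221_iff` is the literal form).
[cite: Balaban1984PropagatorsII, (2.21) p.226] -/
def EL221 (x : A) (lam : V) (ω : W) : Prop :=
  ΔA x - d (Rp lam) - Qs ω = 0 ∧ Rp (dstar x) = 0 ∧ Q x = B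

/-- (2.21) in its literal printed form `… = 0, −R∂*A = 0, −(QA − B) = 0`. [cite: Balaban1984PropagatorsII, (2.21) p.226] -/
theorem el221_iff (x : A) (lam : V) (ω : W) :
    EL221 ΔA d dstar Rp Q Qs B x lam ω ↔
      ΔA x - d (Rp lam) - Qs ω = 0 ∧ -(Rp (dstar x)) = 0 ∧ -(Q x - B) = 0 := by
  simp only [EL221, neg_eq_zero, sub_eq_zero]

end Variations

/-! ### The three variations as GRADIENTS -/

section Gradients

/-- A real function with an exact expansion `f(x + v) = f x + ⟨v, g⟩ + q v`, `|q v| ≤ C‖v‖²`, has gradient `g` at `x`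
(the remainder is `o(‖v‖)`). [folklore] -/
private theorem hasGradientAt_of_expansion [CompleteSpace A] (f : A → ℝ) (g x : A) (q : A → ℝ) {C : ℝ} (hC : 0 ≤ C)
    (hexp : ∀ v, f (x + v) = f x + ⟪v, g⟫_ℝ + q v) (hq : ∀ v, |q v| ≤ C * ‖v‖ ^ 2) :
    HasGradientAt f g x := by
  rw [hasGradientAt_iff_hasFDerivAt, hasFDerivAt_iff_isLittleO_nhds_zero]
  have hrem : (fun v : A => f (x + v) - f x - (toDual ℝ A g) v) = q := by
    funext v
    rw [hexp v, toDual_apply_apply, real_inner_comm]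
    ring
  rw [hrem]
  refine Asymptotics.IsLittleO.of_bound fun ε hε => ?_
  rw [Metric.eventually_nhds_iff]
  refine ⟨ε / (C + 1), div_pos hε (by linarith), fun v hv => ?_⟩
  rw [dist_zero_right] at hv
  rw [Real.norm_eq_abs]
  have h1 : C * ‖v‖ ≤ ε := by
    have h2 : C * ‖v‖ ≤ C * (ε / (C + 1)) := mul_le_mul_of_nonneg_left hv.le hC
    have h3 : C * (ε / (C + 1)) ≤ ε := by
      rw [mul_div_assoc', div_le_iff₀ (by linarith : (0 : ℝ) < C + 1)]
      nlinarith
    linarith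
  calc |q v| ≤ C * ‖v‖ ^ 2 := hq v
    _ = (C * ‖v‖) * ‖v‖ := by ring
    _ ≤ ε * ‖v‖ := mul_le_mul_of_nonneg_right h1 (norm_nonneg v)

variable (ΔA : A →ₗ[ℝ] A) (a : W →ₗ[ℝ] W) (d : V →ₗ[ℝ] A) (dstar : A →ₗ[ℝ] V) (Rp : V →ₗ[ℝ] V)
  (Q : A →ₗ[ℝ] W) (Qs : W →ₗ[ℝ] A) (B : W)

/-- **δh/δA = Δ_aA − ∂Rλ − Q*ω (2.21), as a gradient** (`A` finite-dimensional, so that `Δ_a` is continuous and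
`h(·, λ, ω)` differentiable; hypotheses as in `lagrangeH_add_A`). [cite: Balaban1984PropagatorsII, (2.21) p.226] -/
theorem hasGradientAt_A [FiniteDimensional ℝ A] (hΔ : ∀ x y : A, ⟪ΔA x, y⟫_ℝ = ⟪x, ΔA y⟫_ℝ)
    (hd : ∀ (v : V) (x : A), ⟪d v, x⟫_ℝ = ⟪v, dstar x⟫_ℝ) (hR : ∀ u v : V, ⟪Rp u, v⟫_ℝ = ⟪u, Rp v⟫_ℝ)
    (hQ : ∀ (w : W) (x : A), ⟪Qs w, x⟫_ℝ = ⟪w, Q x⟫_ℝ) (x : A) (lam : V) (ω : W) :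
    HasGradientAt (fun y => lagrangeH ΔA a dstar Rp Q B y lam ω) (ΔA x - d (Rp lam) - Qs ω) x := by
  have hT : 0 ≤ (1 / 2) * ‖LinearMap.toContinuousLinearMap ΔA‖ := by positivity
  refine hasGradientAt_of_expansion _ _ _ (fun v => (1 / 2) * ⟪v, ΔA v⟫_ℝ) hT
    (fun v => lagrangeH_add_A ΔA a d dstar Rp Q Qs B hΔ hd hR hQ x v lam ω) (fun v => ?_)
  have h1 : |⟪v, ΔA v⟫_ℝ| ≤ ‖v‖ * ‖ΔA v‖ := abs_real_inner_le_norm v (ΔA v)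
  have h2 : ‖ΔA v‖ ≤ ‖LinearMap.toContinuousLinearMap ΔA‖ * ‖v‖ := by
    simpa using (LinearMap.toContinuousLinearMap ΔA).le_opNorm v
  have h3 : |⟪v, ΔA v⟫_ℝ| ≤ ‖v‖ * (‖LinearMap.toContinuousLinearMap ΔA‖ * ‖v‖) :=
    h1.trans (mul_le_mul_of_nonneg_left h2 (norm_nonneg v))
  rw [abs_mul, abs_of_pos (by norm_num : (0 : ℝ) < 1 / 2)]
  calc (1 / 2) * |⟪v, ΔA v⟫_ℝ| ≤ (1 / 2) * (‖v‖ * (‖LinearMap.toContinuousLinearMap ΔA‖ * ‖v‖)) := by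
        linarith
    _ = (1 / 2) * ‖LinearMap.toContinuousLinearMap ΔA‖ * ‖v‖ ^ 2 := by ring

/-- **δh/δλ = −R∂*A (2.21), as a gradient.** [cite: Balaban1984PropagatorsII, (2.21) p.226] -/
theorem hasGradientAt_lam [CompleteSpace V] (x : A) (lam : V) (ω : W) :
    HasGradientAt (fun μ => lagrangeH ΔA a dstar Rp Q B x μ ω) (-(Rp (dstar x))) lam := by
  refine hasGradientAt_of_expansion _ _ _ (fun _ => 0) le_rfl (fun v => ?_) (fun v => by simp)
  rw [lagrangeH_add_lam, inner_neg_right]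
  ring

/-- **δh/δω = −(QA − B) (2.21), as a gradient.** [cite: Balaban1984PropagatorsII, (2.21) p.226] -/
theorem hasGradientAt_omega [CompleteSpace W] (x : A) (lam : V) (ω : W) :
    HasGradientAt (fun ν => lagrangeH ΔA a dstar Rp Q B x lam ν) (-(Q x - B)) ω := by
  refine hasGradientAt_of_expansion _ _ _ (fun _ => 0) le_rfl (fun v => ?_) (fun v => by simp)
  rw [lagrangeH_add_omega, inner_neg_right]
  ring

/-- **(2.21) ⟺ `h` is stationary**: the system (2.21) holds at `(A, λ, ω)` iff the three gradients of (2.18) vanish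
there. [cite: Balaban1984PropagatorsII, (2.21) p.226] -/
theorem el221_iff_gradient_eq_zero [FiniteDimensional ℝ A] [CompleteSpace V] [CompleteSpace W]
    (hΔ : ∀ x y : A, ⟪ΔA x, y⟫_ℝ = ⟪x, ΔA y⟫_ℝ)
    (hd : ∀ (v : V) (x : A), ⟪d v, x⟫_ℝ = ⟪v, dstar x⟫_ℝ) (hR : ∀ u v : V, ⟪Rp u, v⟫_ℝ = ⟪u, Rp v⟫_ℝ)
    (hQ : ∀ (w : W) (x : A), ⟪Qs w, x⟫_ℝ = ⟪w, Q x⟫_ℝ) (x : A) (lam : V) (ω : W) :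
    EL221 ΔA d dstar Rp Q Qs B x lam ω ↔
      ∇ (fun y => lagrangeH ΔA a dstar Rp Q B y lam ω) x = 0 ∧
        ∇ (fun μ => lagrangeH ΔA a dstar Rp Q B x μ ω) lam = 0 ∧
          ∇ (fun ν => lagrangeH ΔA a dstar Rp Q B x lam ν) ω = 0 := by
  rw [(hasGradientAt_A ΔA a d dstar Rp Q Qs B hΔ hd hR hQ x lam ω).gradient,
    (hasGradientAt_lam ΔA a dstar Rp Q B x lam ω).gradient,
    (hasGradientAt_omega ΔA a dstar Rp Q B x lam ω).gradient]
  exact el221_iff ΔA d dstar Rp Q Qs B x lam ω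

end Gradients

/-! ## §4 the value of `h` on the admissible set: `h = ½·(2.5)` -/

section Principle

variable (ΔA : A →ₗ[ℝ] A) (a : W →ₗ[ℝ] W) (dc : A →ₗ[ℝ] P) (dcs : P →ₗ[ℝ] A) (d : V →ₗ[ℝ] A)
  (dstar : A →ₗ[ℝ] V) (Rp : V →ₗ[ℝ] V) (Q : A →ₗ[ℝ] W) (Qs : W →ₗ[ℝ] A) (B : W)

/-- The quadratic form of (2.19) `Δ_a = ∂*∂ + ∂R∂* + Q*aQ`:
`⟨A′, Δ_aA″⟩ = ⟨∂A′, ∂A″⟩ + ⟨∂*A′, R∂*A″⟩ + ⟨QA′, aQA″⟩`. [cite: Balaban1984PropagatorsII, (2.19) p.226] -/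
theorem inner_deltaA (hΔa : ΔA = dcs ∘ₗ dc + d ∘ₗ Rp ∘ₗ dstar + Qs ∘ₗ a ∘ₗ Q)
    (hdc : ∀ (p : P) (x : A), ⟪dcs p, x⟫_ℝ = ⟪p, dc x⟫_ℝ)
    (hd : ∀ (v : V) (x : A), ⟪d v, x⟫_ℝ = ⟪v, dstar x⟫_ℝ)
    (hQ : ∀ (w : W) (x : A), ⟪Qs w, x⟫_ℝ = ⟪w, Q x⟫_ℝ) (x y : A) :
    ⟪x, ΔA y⟫_ℝ = ⟪dc x, dc y⟫_ℝ + ⟪dstar x, Rp (dstar y)⟫_ℝ + ⟪Q x, a (Q y)⟫_ℝ := by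
  have e1 : ⟪x, dcs (dc y)⟫_ℝ = ⟪dc x, dc y⟫_ℝ := by rw [real_inner_comm, hdc, real_inner_comm]
  have e2 : ⟪x, d (Rp (dstar y))⟫_ℝ = ⟪dstar x, Rp (dstar y)⟫_ℝ := by rw [real_inner_comm, hd, real_inner_comm]
  have e3 : ⟪x, Qs (a (Q y))⟫_ℝ = ⟪Q x, a (Q y)⟫_ℝ := by rw [real_inner_comm, hQ, real_inner_comm]
  subst hΔa
  simp only [LinearMap.add_apply, LinearMap.coe_comp, Function.comp_apply, inner_add_right]
  rw [e1, e2, e3]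

/-- **The design of (2.18)**: on the admissible set (2.6), (2.12) the Lagrange functional equals half the functional
(2.5), `h(A, λ, ω) = ½‖∂A‖²` (the terms `½a⟨QA,QA⟩ − ½a⟨B,B⟩`, `½‖R∂*A‖²`, `⟨λ, R∂*A⟩`, `⟨ω, QA − B⟩` vanish).
[cite: Balaban1984PropagatorsII, (2.18)–(2.19) p.226] -/
theorem lagrangeH_eq_half_energy (hΔa : ΔA = dcs ∘ₗ dc + d ∘ₗ Rp ∘ₗ dstar + Qs ∘ₗ a ∘ₗ Q)
    (hdc : ∀ (p : P) (x : A), ⟪dcs p, x⟫_ℝ = ⟪p, dc x⟫_ℝ)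
    (hd : ∀ (v : V) (x : A), ⟪d v, x⟫_ℝ = ⟪v, dstar x⟫_ℝ)
    (hQ : ∀ (w : W) (x : A), ⟪Qs w, x⟫_ℝ = ⟪w, Q x⟫_ℝ) {x : A} (hx : Admissible Q dstar Rp B x)
    (lam : V) (ω : W) :
    lagrangeH ΔA a dstar Rp Q B x lam ω = (1 / 2) * energy dc x := by
  have h1 := inner_deltaA ΔA a dc dcs d dstar Rp Q Qs hΔa hdc hd hQ x x
  unfold lagrangeH energy
  rw [h1, hx.2, hx.1, sub_self, inner_zero_right, inner_zero_right, inner_zero_right,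
    real_inner_self_eq_norm_sq]
  ring

/-! ## §5 the Lagrange principle: (2.21) ⟺ critical configuration of (2.5) under (2.6), (2.12) -/

/-- **Sufficiency**: a solution `(A, λ, ω)` of (2.21) is a critical configuration of (2.5) satisfying (2.6), (2.12)
(*"it gives a solution of the above variational problem"*, p. 226). [cite: Balaban1984PropagatorsII, (2.21) p.226 + p.228 after (2.35)] -/
theorem isCritical_of_el221 (hΔa : ΔA = dcs ∘ₗ dc + d ∘ₗ Rp ∘ₗ dstar + Qs ∘ₗ a ∘ₗ Q)
    (hdc : ∀ (p : P) (x : A), ⟪dcs p, x⟫_ℝ = ⟪p, dc x⟫_ℝ)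
    (hd : ∀ (v : V) (x : A), ⟪d v, x⟫_ℝ = ⟪v, dstar x⟫_ℝ) (hR : ∀ u v : V, ⟪Rp u, v⟫_ℝ = ⟪u, Rp v⟫_ℝ)
    (hQ : ∀ (w : W) (x : A), ⟪Qs w, x⟫_ℝ = ⟪w, Q x⟫_ℝ) {x : A} {lam : V} {ω : W}
    (h : EL221 ΔA d dstar Rp Q Qs B x lam ω) : IsCritical dc Q dstar Rp B x := by
  obtain ⟨h1, h2, h3⟩ := h
  refine ⟨⟨h3, h2⟩, fun v hv => ?_⟩
  rw [mem_tangent_iff] at hv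
  have hΔx : ΔA x = d (Rp lam) + Qs ω := by
    rw [sub_sub, sub_eq_zero] at h1
    exact h1
  have e := inner_deltaA ΔA a dc dcs d dstar Rp Q Qs hΔa hdc hd hQ v x
  rw [h2, hv.1, inner_zero_right, inner_zero_left, add_zero, add_zero] at e
  have e1 : ⟪v, d (Rp lam)⟫_ℝ = 0 := by rw [real_inner_comm, hd, hR, hv.2, inner_zero_right]
  have e2 : ⟪v, Qs ω⟫_ℝ = 0 := by rw [real_inner_comm, hQ, hv.1, inner_zero_right]
  rw [real_inner_comm, ← e, hΔx, inner_add_right, e1, e2, add_zero]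

/-- **A critical configuration minimises (2.5) on the admissible set** (convexity: `‖∂y‖² = ‖∂x‖² + ‖∂(y − x)‖²`
when `x` is critical and `y` admissible). [cite: Balaban1984PropagatorsII, (2.5)–(2.6) p.224 + p.226 before (2.18)] -/
theorem energy_le_of_isCritical {x : A} (hx : IsCritical dc Q dstar Rp B x) {y : A}
    (hy : Admissible Q dstar Rp B y) : energy dc x ≤ energy dc y := by
  have hv := sub_mem_tangent hx.1 hy
  have h := energy_add dc x (y - x)
  rw [add_sub_cancel, hx.2 _ hv, mul_zero, add_zero] at h
  rw [h]
  exact le_add_of_nonneg_right (energy_nonneg dc _)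

/-- `ker Q = (ran Q*)ᗮ` for an adjoint pair. [folklore] -/
private theorem ker_eq_orthogonal_range {Q : A →ₗ[ℝ] W} {Qs : W →ₗ[ℝ] A}
    (hQ : ∀ (w : W) (x : A), ⟪Qs w, x⟫_ℝ = ⟪w, Q x⟫_ℝ) :
    LinearMap.ker Q = (LinearMap.range Qs)ᗮ := by
  ext v
  rw [LinearMap.mem_ker, Submodule.mem_orthogonal]
  constructor
  · intro hv u hu
    obtain ⟨w, rfl⟩ := LinearMap.mem_range.mp hu
    rw [hQ, hv, inner_zero_right]
  · intro h
    have h' : ⟪Q v, Q v⟫_ℝ = 0 := by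
      rw [← hQ]
      exact h _ (LinearMap.mem_range_self Qs (Q v))
    exact inner_self_eq_zero.mp h'

/-- The tangent space of (2.6), (2.12) is the orthogonal complement of `ran Q* + ran ∂R` (`R` symmetric).
[cite: Balaban1984PropagatorsII, (2.6) p.224 + (2.12) p.225] -/
theorem tangent_eq_orthogonal (hd : ∀ (v : V) (x : A), ⟪d v, x⟫_ℝ = ⟪v, dstar x⟫_ℝ)
    (hR : ∀ u v : V, ⟪Rp u, v⟫_ℝ = ⟪u, Rp v⟫_ℝ) (hQ : ∀ (w : W) (x : A), ⟪Qs w, x⟫_ℝ = ⟪w, Q x⟫_ℝ) :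
    tangent Q dstar Rp = (LinearMap.range Qs ⊔ LinearMap.range (d ∘ₗ Rp))ᗮ := by
  have hadj : ∀ (u : V) (x : A), ⟪(d ∘ₗ Rp) u, x⟫_ℝ = ⟪u, (Rp ∘ₗ dstar) x⟫_ℝ := fun u x => by
    simp only [LinearMap.coe_comp, Function.comp_apply]
    rw [hd, hR]
  rw [tangent, ← Submodule.inf_orthogonal, ker_eq_orthogonal_range hQ, ker_eq_orthogonal_range hadj]

/-- **Necessity (Lagrange multipliers exist)**: on a finite-dimensional `A`, with `R` an orthogonal projection
(symmetric, idempotent), every critical configuration of (2.5) under (2.6), (2.12) admits multipliers `λ = Rλ`, `ω`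
solving (2.21): the gradient `∂*∂A` of `½‖∂A‖²` is orthogonal to `ker Q ∩ ker R∂*`, hence lies in `ran Q* + ran ∂R`.
[cite: Balaban1984PropagatorsII, (2.18)–(2.21) p.226] -/
theorem exists_el221_of_isCritical [FiniteDimensional ℝ A]
    (hΔa : ΔA = dcs ∘ₗ dc + d ∘ₗ Rp ∘ₗ dstar + Qs ∘ₗ a ∘ₗ Q)
    (hdc : ∀ (p : P) (x : A), ⟪dcs p, x⟫_ℝ = ⟪p, dc x⟫_ℝ)
    (hd : ∀ (v : V) (x : A), ⟪d v, x⟫_ℝ = ⟪v, dstar x⟫_ℝ) (hR : ∀ u v : V, ⟪Rp u, v⟫_ℝ = ⟪u, Rp v⟫_ℝ)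
    (hRR : Rp ∘ₗ Rp = Rp) (hQ : ∀ (w : W) (x : A), ⟪Qs w, x⟫_ℝ = ⟪w, Q x⟫_ℝ) {x : A}
    (hx : IsCritical dc Q dstar Rp B x) :
    ∃ (lam : V) (ω : W), Rp lam = lam ∧ EL221 ΔA d dstar Rp Q Qs B x lam ω := by
  obtain ⟨⟨hQx, hRx⟩, hcrit⟩ := hx
  have hg : dcs (dc x) ∈ (tangent Q dstar Rp)ᗮ := by
    rw [Submodule.mem_orthogonal]
    intro v hv
    rw [real_inner_comm, hdc]
    exact hcrit v hv
  rw [tangent_eq_orthogonal d dstar Rp Q Qs hd hR hQ, Submodule.orthogonal_orthogonal] at hg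
  obtain ⟨y, hy, z, hz, hyz⟩ := Submodule.mem_sup.mp hg
  obtain ⟨ω', rfl⟩ := LinearMap.mem_range.mp hy
  obtain ⟨lam', rfl⟩ := LinearMap.mem_range.mp hz
  have hRR' : Rp (Rp lam') = Rp lam' := by
    simpa using LinearMap.congr_fun hRR lam'
  refine ⟨Rp lam', ω' + a B, hRR', ?_, hRx, hQx⟩
  rw [hRR', hΔa]
  simp only [LinearMap.add_apply, LinearMap.coe_comp, Function.comp_apply, map_add]
  rw [hRx, map_zero, hQx, ← hyz]
  simp only [LinearMap.coe_comp, Function.comp_apply]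
  abel

/-- **(2.21) ⟺ critical configuration**, multipliers existentially quantified (finite-dimensional `A`, `R` an
orthogonal projection). [cite: Balaban1984PropagatorsII, (2.18)–(2.21) p.226] -/
theorem isCritical_iff_exists_el221 [FiniteDimensional ℝ A]
    (hΔa : ΔA = dcs ∘ₗ dc + d ∘ₗ Rp ∘ₗ dstar + Qs ∘ₗ a ∘ₗ Q)
    (hdc : ∀ (p : P) (x : A), ⟪dcs p, x⟫_ℝ = ⟪p, dc x⟫_ℝ)
    (hd : ∀ (v : V) (x : A), ⟪d v, x⟫_ℝ = ⟪v, dstar x⟫_ℝ) (hR : ∀ u v : V, ⟪Rp u, v⟫_ℝ = ⟪u, Rp v⟫_ℝ)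
    (hRR : Rp ∘ₗ Rp = Rp) (hQ : ∀ (w : W) (x : A), ⟪Qs w, x⟫_ℝ = ⟪w, Q x⟫_ℝ) (x : A) :
    IsCritical dc Q dstar Rp B x ↔ ∃ (lam : V) (ω : W), Rp lam = lam ∧ EL221 ΔA d dstar Rp Q Qs B x lam ω :=
  ⟨exists_el221_of_isCritical ΔA a dc dcs d dstar Rp Q Qs B hΔa hdc hd hR hRR hQ,
    fun ⟨_, _, _, h⟩ => isCritical_of_el221 ΔA a dc dcs d dstar Rp Q Qs B hΔa hdc hd hR hQ h⟩

/-! ## §6 "exactly one critical configuration of (2.5) satisfying (2.6), (2.12), and given by (2.35)" -/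

/-- **Uniqueness, for (2.5) itself** (p. 228): with `G` a left inverse of `Δ_a`, the Faddeev–Popov identities (2.31)
`R∂*G∂R = R`, (2.34) `R∂*GQ* = 0`, and `E` a left inverse of `QGQ*` — the inputs of `B6SectA.critical221_unique` —
every critical configuration of (2.5) satisfying (2.6), (2.12) is `HB = GQ*(QGQ*)⁻¹B` (2.35).
[cite: Balaban1984PropagatorsII, (2.35) p.228] -/
theorem isCritical_unique [FiniteDimensional ℝ A]
    (hΔa : ΔA = dcs ∘ₗ dc + d ∘ₗ Rp ∘ₗ dstar + Qs ∘ₗ a ∘ₗ Q)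
    (hdc : ∀ (p : P) (x : A), ⟪dcs p, x⟫_ℝ = ⟪p, dc x⟫_ℝ)
    (hd : ∀ (v : V) (x : A), ⟪d v, x⟫_ℝ = ⟪v, dstar x⟫_ℝ) (hR : ∀ u v : V, ⟪Rp u, v⟫_ℝ = ⟪u, Rp v⟫_ℝ)
    (hRR : Rp ∘ₗ Rp = Rp) (hQ : ∀ (w : W) (x : A), ⟪Qs w, x⟫_ℝ = ⟪w, Q x⟫_ℝ)
    (G : A →ₗ[ℝ] A) (E : W →ₗ[ℝ] W) (hG : G ∘ₗ ΔA = LinearMap.id)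
    (h231 : Rp ∘ₗ dstar ∘ₗ G ∘ₗ d ∘ₗ Rp = Rp) (h234 : Rp ∘ₗ dstar ∘ₗ G ∘ₗ Qs = 0)
    (hE : E ∘ₗ (Q ∘ₗ G ∘ₗ Qs) = LinearMap.id) {x : A} (hx : IsCritical dc Q dstar Rp B x) :
    x = B6SectA.hOp G Qs E B := by
  obtain ⟨lam, ω, hRl, h1, h2, h3⟩ :=
    exists_el221_of_isCritical ΔA a dc dcs d dstar Rp Q Qs B hΔa hdc hd hR hRR hQ hx
  exact (B6SectA.critical221_unique ΔA G d dstar Rp Q Qs E hG h231 h234 hE hRl h1 h2 h3).2.2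

/-- **Existence, for (2.5) itself** (p. 228): with `G` a right inverse of `Δ_a`, (2.34) and `E` a right inverse of
`QGQ*` — the inputs of `B6SectA.critical221_exists` — `HB` (2.35) is a critical configuration of (2.5) satisfying
(2.6), (2.12). [cite: Balaban1984PropagatorsII, (2.35) p.228] -/
theorem isCritical_hOp (hΔa : ΔA = dcs ∘ₗ dc + d ∘ₗ Rp ∘ₗ dstar + Qs ∘ₗ a ∘ₗ Q)
    (hdc : ∀ (p : P) (x : A), ⟪dcs p, x⟫_ℝ = ⟪p, dc x⟫_ℝ)
    (hd : ∀ (v : V) (x : A), ⟪d v, x⟫_ℝ = ⟪v, dstar x⟫_ℝ) (hR : ∀ u v : V, ⟪Rp u, v⟫_ℝ = ⟪u, Rp v⟫_ℝ)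
    (hQ : ∀ (w : W) (x : A), ⟪Qs w, x⟫_ℝ = ⟪w, Q x⟫_ℝ)
    (G : A →ₗ[ℝ] A) (E : W →ₗ[ℝ] W) (hG' : ΔA ∘ₗ G = LinearMap.id)
    (h234 : Rp ∘ₗ dstar ∘ₗ G ∘ₗ Qs = 0) (hE' : (Q ∘ₗ G ∘ₗ Qs) ∘ₗ E = LinearMap.id) :
    IsCritical dc Q dstar Rp B (B6SectA.hOp G Qs E B) := by
  obtain ⟨_, h1, h2, h3⟩ := B6SectA.critical221_exists ΔA G d dstar Rp Q Qs E hG' h234 hE' B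
  exact isCritical_of_el221 ΔA a dc dcs d dstar Rp Q Qs B hΔa hdc hd hR hQ ⟨h1, h2, h3⟩

/-- ***"exactly one critical configuration of (2.5) satisfying (2.6), (2.12), and given by (2.35)"*** (p. 228), as a
theorem about the variational problem (2.5) itself: `∃! A, IsCritical … B A`, under the inputs the text names
(`Δ_a` invertible with inverse `G`, `QGQ*` invertible with inverse `E`, (2.31), (2.34)).
[cite: Balaban1984PropagatorsII, (2.35) p.228] -/
theorem existsUnique_isCritical [FiniteDimensional ℝ A]
    (hΔa : ΔA = dcs ∘ₗ dc + d ∘ₗ Rp ∘ₗ dstar + Qs ∘ₗ a ∘ₗ Q)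
    (hdc : ∀ (p : P) (x : A), ⟪dcs p, x⟫_ℝ = ⟪p, dc x⟫_ℝ)
    (hd : ∀ (v : V) (x : A), ⟪d v, x⟫_ℝ = ⟪v, dstar x⟫_ℝ) (hR : ∀ u v : V, ⟪Rp u, v⟫_ℝ = ⟪u, Rp v⟫_ℝ)
    (hRR : Rp ∘ₗ Rp = Rp) (hQ : ∀ (w : W) (x : A), ⟪Qs w, x⟫_ℝ = ⟪w, Q x⟫_ℝ)
    (G : A →ₗ[ℝ] A) (E : W →ₗ[ℝ] W) (hG : G ∘ₗ ΔA = LinearMap.id) (hG' : ΔA ∘ₗ G = LinearMap.id)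
    (h231 : Rp ∘ₗ dstar ∘ₗ G ∘ₗ d ∘ₗ Rp = Rp) (h234 : Rp ∘ₗ dstar ∘ₗ G ∘ₗ Qs = 0)
    (hE : E ∘ₗ (Q ∘ₗ G ∘ₗ Qs) = LinearMap.id) (hE' : (Q ∘ₗ G ∘ₗ Qs) ∘ₗ E = LinearMap.id) :
    ∃! x, IsCritical dc Q dstar Rp B x :=
  ⟨B6SectA.hOp G Qs E B, isCritical_hOp ΔA a dc dcs d dstar Rp Q Qs B hΔa hdc hd hR hQ G E hG' h234 hE',
    fun _ hy => isCritical_unique ΔA a dc dcs d dstar Rp Q Qs B hΔa hdc hd hR hRR hQ G E hG h231 h234 hE hy⟩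

/-- And that configuration MINIMISES (2.5) on the admissible set: *"it gives a solution of the above variational
problem"* (p. 226). [cite: Balaban1984PropagatorsII, p.226 before (2.21) + (2.35) p.228] -/
theorem energy_hOp_le (hΔa : ΔA = dcs ∘ₗ dc + d ∘ₗ Rp ∘ₗ dstar + Qs ∘ₗ a ∘ₗ Q)
    (hdc : ∀ (p : P) (x : A), ⟪dcs p, x⟫_ℝ = ⟪p, dc x⟫_ℝ)
    (hd : ∀ (v : V) (x : A), ⟪d v, x⟫_ℝ = ⟪v, dstar x⟫_ℝ) (hR : ∀ u v : V, ⟪Rp u, v⟫_ℝ = ⟪u, Rp v⟫_ℝ)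
    (hQ : ∀ (w : W) (x : A), ⟪Qs w, x⟫_ℝ = ⟪w, Q x⟫_ℝ)
    (G : A →ₗ[ℝ] A) (E : W →ₗ[ℝ] W) (hG' : ΔA ∘ₗ G = LinearMap.id)
    (h234 : Rp ∘ₗ dstar ∘ₗ G ∘ₗ Qs = 0) (hE' : (Q ∘ₗ G ∘ₗ Qs) ∘ₗ E = LinearMap.id)
    {y : A} (hy : Admissible Q dstar Rp B y) :
    energy dc (B6SectA.hOp G Qs E B) ≤ energy dc y :=
  energy_le_of_isCritical dc dstar Rp Q B
    (isCritical_hOp ΔA a dc dcs d dstar Rp Q Qs B hΔa hdc hd hR hQ G E hG' h234 hE') hy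

end Principle

end Literature.MathematicalPhysics.QuantumFieldTheory.Balaban1983to89.B6Eq218Lagrangian

end
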